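import Summits.HubbardSuperconductivity.HubbardSuperconductivity.Theorems.KacWindowPenaltyWindowGapMonotone
import Summits.HubbardSuperconductivity.HubbardSuperconductivity.Theorems.KacWindowPenaltyWindowGapPenalisedForms
import Summits.HubbardSuperconductivity.HubbardSuperconductivity.Theorems.KacWindowPenaltyWindowGapStubFullWindow

/-!
# Crux `WindowGap` (stmt-HubbardSuperconductivity-1088) — line `Sketch` (idea `parabolic-descent`)
# LEAD SKELETON (lead a1 → continuation lead c1, 2026-08-16; stubs registered with `ledger skeleton check`;
# c1: `stub_fullWindow` discharged by the landed p108928 — ONE sorry left, `stub_localCertificate`)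

Line idea (card `Cruxes/WindowGap/Ideas/parabolic-descent.md`, ideator sketch
`Cruxes/WindowGap/SketchIdeator2.lean`): PARABOLIC DESCENT. Concavity of the penalised sector energy
in the coupling `λ` (`windowGapIneq_mono_lam`, landed) + the variational principle at a minimiser of
the SMALLER-window problem give the one-step DESCENT

  `λ A ≤ g(λ; W) − g(0)`  ⟹  `(λ/4)(A − ann) ≤ g(λ/4; W') − g(0)`,
  `ann := Re ⟨ψ', (W − W') ψ'⟩`, `ψ'` any unit minimiser of `H + (λ/4) W'` on the sector

(`descent_step`, PROVED, arbitrary matrices). Iterated along the parabola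
`(ε_k, λ_k) = (ε⋆ 2^{-k}, λ⋆ 4^{-k})` — the scaling the landed twist ceiling `not_windowGap_uniform`
forces — it reduces the crux (`∀ C ∀ ε₀ ∃ ε ≤ ε₀ …`, margins `→ 0`) to ONE base inequality at ONE
scale (`BaseGap`) plus a summable budget for the dyadic ANNULUS pair weights of penalised minimisers
(`AnnulusLaw`; all-energy form `GainLaw`): `windowGapAt_of_parabolicDescent`,
`windowGapAt_of_base_gain` (PROVED; they conclude the crux BODY `WindowGapAt U δ` at the witness point).

Lead's reshaping (this file): the base is moved to the FULL window `ε⋆² ≥ 2π²`, where EVERY momentum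
label passes the window test and `W_ε = Σ_x P_xᴴ P_x` is a LOCAL pair repulsion (operator Parseval,
`sum_conjTranspose_pairFieldAt_mul_self`) — the only form in which the route's engine (certified
two-sided ENERGY-DENSITY bounds for translation-invariant LOCAL Hamiltonians) addresses the base
without momentum-space machinery; by window nesting the full-window base is also the WEAKEST base
hypothesis for given `(λ⋆, A⋆)`. Composition (sorry-free outside the two `stub_*`):
* `stub_fullWindow` — `2π² ≤ ε² → kacWindowOp L ε = Σ_x P_xᴴ P_x` (finite Fourier analysis; provable now);
* `stub_localCertificate` — THE PHYSICS (open; no supplier in print): some `U > 0`, `δ ∈ (0,1/2)`,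
  `ε⋆ ≥ π√2`, `λ⋆, a₀ > 0`, slope `A⋆`, budget `b` with `BaseGapLocal U δ λ⋆ A⋆` (local base certificate),
  `GainLaw U δ ε⋆ λ⋆ b` (per-level ceilings on the energy an attractive Kac-ANNULUS pair interaction gains
  in the penalised problem) and `2a₀ ≤ A⋆ − Σ_{k<K} b_k` for all `K`;
* `WindowGap_of` — `baseGap_of_local` (via `stub_fullWindow`) then `windowGapAt_of_base_gain`; the
  only theorem concluding the crux by name.
No named fact; definitions `kacWindowOp`, `holeSector`, `penGap`, `BaseGap`, `AnnulusLaw`, `GainLaw`,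
`localPairRepulsion`, `BaseGapLocal` are the line's vocabulary (skeleton-local; landed files inline them).
-/

set_option linter.dupNamespace false

noncomputable section

namespace Summit.HubbardSuperconductivity.HubbardSuperconductivity.Cruxes.WindowGap.ParabolicDescent

open Matrix Literature.MathematicalPhysics.QuantumLattice
open Summit.HubbardSuperconductivity.HubbardSuperconductivity.Theorems
open Summit.HubbardSuperconductivity.HubbardSuperconductivity.Theses.KacWindowPenalty (WindowGap)

section Abstract

variable {n : Type*} [Fintype n]

/-- **Descent step (first lemma of the line; PROVED).** For matrices `H, W, W'`, a sector `K`,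
couplings `0 < λ' ≤ λ`, a gap `λ A ≤ minE(H + λW | K) − minE(H | K)` and ANY unit minimiser `ψ`
of `H + λ'W'` on `K`:  `λ'(A − Re⟨ψ,(W − W')ψ⟩) ≤ minE(H + λ'W' | K) − minE(H | K)`.
Proof: chord monotonicity in the coupling (`windowGapIneq_mono_lam`) brings the gap down to `λ'`,
and the variational principle for `H + λ'W` at `ψ` reads
`minE(H + λ'W) ≤ Re⟨ψ,(H + λ'W')ψ⟩ + λ' Re⟨ψ,(W − W')ψ⟩ = minE(H + λ'W') + λ'·ann`. [folklore] -/
theorem descent_step (H W W' : Matrix n n ℂ) (K : Submodule ℂ (n → ℂ)) {lam lam' A : ℝ}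
    (hlam' : 0 < lam') (hle : lam' ≤ lam)
    (hgap : lam * A ≤ (H + (lam : ℂ) • W).minEnergyOn K - H.minEnergyOn K)
    {ψ : n → ℂ} (hψK : ψ ∈ K) (hψ : star ψ ⬝ᵥ ψ = 1)
    (hmin : (star ψ ⬝ᵥ (H + (lam' : ℂ) • W') *ᵥ ψ).re = (H + (lam' : ℂ) • W').minEnergyOn K) :
    lam' * (A - (star ψ ⬝ᵥ (W - W') *ᵥ ψ).re) ≤
      (H + (lam' : ℂ) • W').minEnergyOn K - H.minEnergyOn K := by
  have h1 := windowGapIneq_mono_lam H W K hlam' hle hgap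
  have h2 := minEnergyOn_le_re_rayleigh (H + (lam' : ℂ) • W) K hψK hψ
  rw [add_mulVec, dotProduct_add, Complex.add_re, smul_mulVec, dotProduct_smul, smul_eq_mul,
    Complex.re_ofReal_mul] at h2 hmin
  rw [sub_mulVec, dotProduct_sub, Complex.sub_re, mul_sub, mul_sub]
  linarith

end Abstract

/-! ### The route's objects -/

variable (L : ℕ) [NeZero L]

/-- The Kac-window pair penalty `W_ε = L⁻² Σ_{|q_m| ≤ ε} Δ_d(m)ᴴ Δ_d(m)` — verbatim the crux's
`let W` with `D m := pairFieldAt dWaveFormFactor L m` (`pairFieldAt_def` is `rfl`). [folklore] -/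
def kacWindowOp (ε : ℝ) :
    Matrix (Finset (Orb (FermionTorus 2 L))) (Finset (Orb (FermionTorus 2 L))) ℂ :=
  ∑ m : Fin 2 → ZMod L,
    if (2 * Real.pi / (L : ℝ)) ^ 2 * (∑ i : Fin 2, (((m i).valMinAbs : ℤ) : ℝ) ^ 2) ≤ ε ^ 2 then
      ((L : ℂ) ^ 2)⁻¹ • (Matrix.conjTranspose (pairFieldAt dWaveFormFactor L m) *
        pairFieldAt dWaveFormFactor L m)
    else 0

/-- The summit's sector `K_L = szSector N_L 0`, `N_L = 2⌊(1−δ)L²/2⌋`. [folklore] -/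
def holeSector (δ : ℝ) : Submodule ℂ (Fock (Orb (FermionTorus 2 L))) :=
  szSector (2 * ⌊(1 - δ) * (L : ℝ) ^ 2 / 2⌋₊) 0

/-- The penalised gap `g_L(λ; ε) − g_L(0) = minE(H_L + λW_ε | K_L) − minE(H_L | K_L)`. [folklore] -/
def penGap (U δ ε lam : ℝ) : ℝ :=
  (hubbardTorus 2 L 1 U + (lam : ℂ) • kacWindowOp L ε).minEnergyOn (holeSector L δ) -
    (hubbardTorus 2 L 1 U).minEnergyOn (holeSector L δ)

/-- **BASE** — the crux's inequality at ONE scale `(ε⋆, λ⋆)` with chord slope `A⋆`: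
`λ⋆ A⋆ L² ≤ g_L(λ⋆; ε⋆) − g_L(0)` for all large even `L`. [folklore] -/
def BaseGap (U δ εs lams As : ℝ) : Prop :=
  ∃ L₀ : ℕ, ∀ (L : ℕ) [NeZero L], L₀ ≤ L → Even L → lams * As * (L : ℝ) ^ 2 ≤ penGap L U δ εs lams

/-- **ANNULUS LAW** along the parabola `(ε_k, λ_k) = (ε⋆/2^k, λ⋆/4^k)` with budget `b`: for every
level `k` and all large even `L`, SOME unit minimiser `ψ` of `H_L + λ_{k+1} W_{ε_{k+1}}` on `K_L`
has dyadic-annulus pair weight `Re⟨ψ, (W_{ε_k} − W_{ε_{k+1}}) ψ⟩ ≤ b_k L²`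
(physically `b_k = (flat pair-fluctuation part, telescoping) + C′ε_k` (Goldstone `1/|q|` tail)).
[folklore] -/
def AnnulusLaw (U δ εs lams : ℝ) (b : ℕ → ℝ) : Prop :=
  ∀ k : ℕ, ∃ L₀ : ℕ, ∀ (L : ℕ) [NeZero L], L₀ ≤ L → Even L →
    ∃ ψ ∈ holeSector L δ, star ψ ⬝ᵥ ψ = 1 ∧
      (star ψ ⬝ᵥ (hubbardTorus 2 L 1 U +
          ((lams / 4 ^ (k + 1) : ℝ) : ℂ) • kacWindowOp L (εs / 2 ^ (k + 1))) *ᵥ ψ).re =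
        (hubbardTorus 2 L 1 U +
          ((lams / 4 ^ (k + 1) : ℝ) : ℂ) • kacWindowOp L (εs / 2 ^ (k + 1))).minEnergyOn
            (holeSector L δ) ∧
      (star ψ ⬝ᵥ (kacWindowOp L (εs / 2 ^ k) - kacWindowOp L (εs / 2 ^ (k + 1))) *ᵥ ψ).re ≤
        b k * (L : ℝ) ^ 2

/-- **The cascade at level `K`** (routine induction on `K` from `descent_step`; bookkeeping only): BASE + ANNULUS LAW give, at every level,
`λ_K (A⋆ − Σ_{k<K} b_k) L² ≤ g_L(λ_K; ε_K) − g_L(0)` for all large even `L`. [folklore] -/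
theorem cascade_level {U δ εs lams As : ℝ} {b : ℕ → ℝ} (hlam : 0 < lams)
    (hbase : BaseGap U δ εs lams As) (hann : AnnulusLaw U δ εs lams b) (K : ℕ) :
    ∃ L₀ : ℕ, ∀ (L : ℕ) [NeZero L], L₀ ≤ L → Even L →
      lams / 4 ^ K * (As - ∑ k ∈ Finset.range K, b k) * (L : ℝ) ^ 2 ≤
        penGap L U δ (εs / 2 ^ K) (lams / 4 ^ K) := by
  induction K with
  | zero =>
    obtain ⟨L₀, h⟩ := hbase
    exact ⟨L₀, fun L _ hL hE => by simpa using h L hL hE⟩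
  | succ K ih =>
    obtain ⟨L₁, h₁⟩ := ih
    obtain ⟨L₂, h₂⟩ := hann K
    refine ⟨max L₁ L₂, fun L _ hL hE => ?_⟩
    obtain ⟨ψ, hψK, hψ, hmin, hannK⟩ := h₂ L (le_of_max_le_right hL) hE
    have hgap := h₁ L (le_of_max_le_left hL) hE
    have hlamK : 0 < lams / 4 ^ (K + 1) := by positivity
    have hle : lams / 4 ^ (K + 1) ≤ lams / 4 ^ K :=
      div_le_div_of_nonneg_left hlam.le (by positivity)
        (pow_le_pow_right₀ (by norm_num) (Nat.le_succ K))
    -- the base-type gap at level K, in the shape `λ_K · A_K` with `A_K := (A⋆ − Σ_{k<K} b_k) L²`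
    have hgap' : lams / 4 ^ K * ((As - ∑ k ∈ Finset.range K, b k) * (L : ℝ) ^ 2) ≤
        (hubbardTorus 2 L 1 U + ((lams / 4 ^ K : ℝ) : ℂ) • kacWindowOp L (εs / 2 ^ K)).minEnergyOn
            (holeSector L δ) - (hubbardTorus 2 L 1 U).minEnergyOn (holeSector L δ) := by
      rw [← mul_assoc]; exact hgap
    have step := descent_step (hubbardTorus 2 L 1 U) (kacWindowOp L (εs / 2 ^ K))
      (kacWindowOp L (εs / 2 ^ (K + 1))) (holeSector L δ) hlamK hle hgap' hψK hψ hmin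
    unfold penGap
    rw [Finset.sum_range_succ]
    have hL2 : (0 : ℝ) ≤ (L : ℝ) ^ 2 := by positivity
    have hkey : lams / 4 ^ (K + 1) * (As - (∑ k ∈ Finset.range K, b k + b K)) * (L : ℝ) ^ 2 ≤
        lams / 4 ^ (K + 1) * ((As - ∑ k ∈ Finset.range K, b k) * (L : ℝ) ^ 2 -
          (star ψ ⬝ᵥ (kacWindowOp L (εs / 2 ^ K) - kacWindowOp L (εs / 2 ^ (K + 1))) *ᵥ ψ).re) := by
      have := mul_le_mul_of_nonneg_left hannK hlamK.le
      nlinarith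
    exact hkey.trans step

/-- The body of the crux `WindowGap` AT a parameter point `(U, δ)` (the crux is
`∃ U > 0, ∃ δ ∈ (0,1/2), WindowGapAt U δ`, definitionally: `penGap` unfolds to the crux's `let`s).
[folklore] -/
def WindowGapAt (U δ : ℝ) : Prop :=
  ∀ C : ℝ, 0 ≤ C → ∀ ε₀ : ℝ, 0 < ε₀ → ∃ ε ∈ Set.Ioc (0 : ℝ) ε₀, ∃ lam a : ℝ, 0 < lam ∧ 0 < a ∧
    ∃ L₀ : ℕ, ∀ (L : ℕ) [NeZero L], L₀ ≤ L → Even L →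
      lam * (C * ε + a) * (L : ℝ) ^ 2 ≤ penGap L U δ ε lam

/-- **The crux body from the parabolic descent**: BASE at one scale + ANNULUS LAW with a budget
leaving `2a₀ > 0` of the base slope ⟹ `WindowGapAt U δ`, with `ε := ε⋆/2^K ≤ ε₀`, `C ε ≤ a₀`,
`λ := λ⋆/4^K`, `a := a₀`. [folklore] -/
theorem windowGapAt_of_parabolicDescent {U δ εs lams As a₀ : ℝ} {b : ℕ → ℝ}
    (hε : 0 < εs) (hlam : 0 < lams) (ha₀ : 0 < a₀)
    (hbase : BaseGap U δ εs lams As) (hann : AnnulusLaw U δ εs lams b)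
    (hbudget : ∀ K : ℕ, 2 * a₀ ≤ As - ∑ k ∈ Finset.range K, b k) :
    WindowGapAt U δ := by
  intro C hC ε₀ hε₀
  -- choose the level: `εs / 2^K ≤ min ε₀ (a₀ / (C+1))`
  obtain ⟨K, hK⟩ : ∃ K : ℕ, εs / 2 ^ K ≤ min ε₀ (a₀ / (C + 1)) := by
    have hpos : 0 < min ε₀ (a₀ / (C + 1)) := lt_min hε₀ (div_pos ha₀ (by linarith))
    obtain ⟨K, hK⟩ := pow_unbounded_of_one_lt (εs / min ε₀ (a₀ / (C + 1))) (by norm_num : (1:ℝ) < 2)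
    refine ⟨K, ?_⟩
    rw [div_le_iff₀ (by positivity)]
    rw [div_lt_iff₀ hpos] at hK
    linarith
  obtain ⟨L₀, hL⟩ := cascade_level hlam hbase hann K
  refine ⟨εs / 2 ^ K, ⟨by positivity, hK.trans (min_le_left _ _)⟩, lams / 4 ^ K, a₀,
    by positivity, ha₀, L₀, ?_⟩
  intro L _ hL₀ hE
  have h := hL L hL₀ hE
  have hCε : C * (εs / 2 ^ K) ≤ a₀ := by
    have h1 : εs / 2 ^ K ≤ a₀ / (C + 1) := hK.trans (min_le_right _ _)
    have h2 : C * (εs / 2 ^ K) ≤ C * (a₀ / (C + 1)) := mul_le_mul_of_nonneg_left h1 hC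
    have h3 : C * (a₀ / (C + 1)) ≤ a₀ := by
      rw [mul_div_assoc', div_le_iff₀ (by linarith)]; nlinarith
    linarith
  have hb := hbudget K
  have hL2 : (0 : ℝ) ≤ (L : ℝ) ^ 2 := by positivity
  have hlamK : 0 ≤ lams / 4 ^ K := by positivity
  calc lams / 4 ^ K * (C * (εs / 2 ^ K) + a₀) * (L : ℝ) ^ 2
      ≤ lams / 4 ^ K * (As - ∑ k ∈ Finset.range K, b k) * (L : ℝ) ^ 2 := by
        apply mul_le_mul_of_nonneg_right _ hL2
        exact mul_le_mul_of_nonneg_left (by linarith) hlamK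
    _ ≤ penGap L U δ (εs / 2 ^ K) (lams / 4 ^ K) := h

/-! ### All-energy closure: the annulus law from GAIN ceilings

The annulus weight is the right-derivative of the penalised sector energy in an auxiliary ATTRACTIVE
annulus coupling; by the variational principle at a minimiser, the MAXIMAL annulus weight over the
minimisers of `X` is at most `(minE(X|K) − minE(X − μA|K))/μ` for every `μ > 0`. Hence the whole line is a
statement about certified ENERGY DIFFERENCES only: one base gap (repulsive window) and, per level, one
ceiling on the gain produced by an attractive Kac-ANNULUS pair interaction. -/

section Gain

variable {n : Type*} [Fintype n]

/-- **Expectation of a minimiser ≤ gain/μ** (one line: the variational principle for `X − μA` at a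
minimiser `ψ` of `X`). [folklore] -/
theorem mul_re_expect_le_gain (X A : Matrix n n ℂ) (K : Submodule ℂ (n → ℂ)) {μ : ℝ}
    {ψ : n → ℂ} (hψK : ψ ∈ K) (hψ : star ψ ⬝ᵥ ψ = 1)
    (hmin : (star ψ ⬝ᵥ X *ᵥ ψ).re = X.minEnergyOn K) :
    μ * (star ψ ⬝ᵥ A *ᵥ ψ).re ≤ X.minEnergyOn K - (X - (μ : ℂ) • A).minEnergyOn K := by
  have h := minEnergyOn_le_re_rayleigh (X - (μ : ℂ) • A) K hψK hψ
  rw [sub_mulVec, dotProduct_sub, Complex.sub_re, smul_mulVec, dotProduct_smul, smul_eq_mul,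
    Complex.re_ofReal_mul, hmin] at h
  linarith

end Gain

/-- **GAIN LAW**: per level `k`, some `μ_k > 0` such that the attractive annulus interaction
`−μ_k (W_{ε_k} − W_{ε_{k+1}})` lowers the level-`(k+1)` penalised sector energy by at most `μ_k b_k L²`.
[folklore] -/
def GainLaw (U δ εs lams : ℝ) (b : ℕ → ℝ) : Prop :=
  ∀ k : ℕ, ∃ μ : ℝ, 0 < μ ∧ ∃ L₀ : ℕ, ∀ (L : ℕ) [NeZero L], L₀ ≤ L → Even L →
    (hubbardTorus 2 L 1 U +
        ((lams / 4 ^ (k + 1) : ℝ) : ℂ) • kacWindowOp L (εs / 2 ^ (k + 1))).minEnergyOn (holeSector L δ) -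
      (hubbardTorus 2 L 1 U +
          ((lams / 4 ^ (k + 1) : ℝ) : ℂ) • kacWindowOp L (εs / 2 ^ (k + 1)) -
        (μ : ℂ) • (kacWindowOp L (εs / 2 ^ k) - kacWindowOp L (εs / 2 ^ (k + 1)))).minEnergyOn
          (holeSector L δ) ≤ μ * b k * (L : ℝ) ^ 2

/-- **Gain ceilings give the annulus law** (minimisers exist on the nonempty sector `K_L`,
`exists_unit_re_rayleigh_eq_minEnergyOn`; then `mul_re_expect_le_gain`). [folklore] -/
theorem annulusLaw_of_gainLaw {U δ εs lams : ℝ} {b : ℕ → ℝ} (hδ : δ ∈ Set.Ioo (0 : ℝ) (1 / 2))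
    (h : GainLaw U δ εs lams b) : AnnulusLaw U δ εs lams b := by
  intro k
  obtain ⟨μ, hμ, L₀, hL⟩ := h k
  refine ⟨L₀, fun L _ hL₀ hE => ?_⟩
  obtain ⟨ψ₀, hψ₀, hψ₀gs⟩ :=
    Summit.HubbardSuperconductivity.NoGo.exists_unit_groundStateInSector_hubbardTorus L 1 U
      (Summit.HubbardSuperconductivity.NoGo.floor_pairNumber_le δ (by linarith [hδ.1]) L)
  obtain ⟨ψ, hψK, hψ, hmin⟩ := exists_unit_re_rayleigh_eq_minEnergyOn
    (hubbardTorus 2 L 1 U + ((lams / 4 ^ (k + 1) : ℝ) : ℂ) • kacWindowOp L (εs / 2 ^ (k + 1)))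
    (holeSector L δ) ⟨ψ₀, hψ₀gs.1, hψ₀⟩
  refine ⟨ψ, hψK, hψ, hmin, ?_⟩
  have hg := mul_re_expect_le_gain _ (kacWindowOp L (εs / 2 ^ k) - kacWindowOp L (εs / 2 ^ (k + 1)))
    (holeSector L δ) (μ := μ) hψK hψ hmin
  have hb := hL L hL₀ hE
  have : μ * (star ψ ⬝ᵥ (kacWindowOp L (εs / 2 ^ k) - kacWindowOp L (εs / 2 ^ (k + 1))) *ᵥ ψ).re ≤
      μ * (b k * (L : ℝ) ^ 2) := by rw [← mul_assoc]; exact hg.trans hb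
  exact le_of_mul_le_mul_left this hμ

/-- **The crux body from energy differences only**: BASE gap + GAIN ceilings + budget ⟹
`WindowGapAt U δ`. [folklore] -/
theorem windowGapAt_of_base_gain {U δ εs lams As a₀ : ℝ} {b : ℕ → ℝ}
    (hδ : δ ∈ Set.Ioo (0 : ℝ) (1 / 2)) (hε : 0 < εs) (hlam : 0 < lams) (ha₀ : 0 < a₀)
    (hbase : BaseGap U δ εs lams As) (hgain : GainLaw U δ εs lams b)
    (hbudget : ∀ K : ℕ, 2 * a₀ ≤ As - ∑ k ∈ Finset.range K, b k) :
    WindowGapAt U δ :=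
  windowGapAt_of_parabolicDescent hε hlam ha₀ hbase (annulusLaw_of_gainLaw hδ hgain) hbudget


/-! ### The base at the FULL window: a LOCAL pair repulsion (lead's reshaping)

The two STUBS below are stated in tree vocabulary only (no skeleton-local definition occurs in a
stub signature), so that a landed `Theorems/…` file proves the registered signature verbatim. -/

/-- The local `d`-wave pair repulsion `Σ_x P_xᴴ P_x`, `P_x = localPair dWaveFormFactor L x` — an
extended-Hubbard-type nearest-neighbour four-fermion term (singlet-bond repulsion in the `B₁g`
channel). [folklore] -/
def localPairRepulsion :
    Matrix (Finset (Orb (FermionTorus 2 L))) (Finset (Orb (FermionTorus 2 L))) ℂ :=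
  ∑ x : Fin 2 → ZMod L, (localPair dWaveFormFactor L x)ᴴ * localPair dWaveFormFactor L x

/-- **Stub `stub_fullWindow` — CLOSED (landed p108928,
`Theorems/KacWindowPenaltyWindowGapStubFullWindow.lean`, decl
`Summit.HubbardSuperconductivity.HubbardSuperconductivity.Theorems.stub_fullWindow`, imported above;
this skeleton-local restatement is discharged by it).** For `ε² ≥ 2π²` every momentum label passes
the window test (`|valMinAbs mᵢ| ≤ L/2`, so `(2π/L)² Σᵢ (valMinAbs mᵢ)² ≤ 2π² ≤ ε²`), whence the
Kac-window penalty is the LOCAL pair repulsion: `W_ε = L⁻² Σ_m Δ_d(m)ᴴ Δ_d(m) = Σ_x P_xᴴ P_x` by the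
operator Parseval identity `sum_conjTranspose_pairFieldAt_mul_self`. Kennedy–Lieb–Shastry, PRL 61
(1988) 2582 (sum rule). [folklore] -/
theorem stub_fullWindow (L : ℕ) [NeZero L] (ε : ℝ) (hε : 2 * Real.pi ^ 2 ≤ ε ^ 2) :
    (∑ m : Fin 2 → ZMod L,
      if (2 * Real.pi / (L : ℝ)) ^ 2 * (∑ i : Fin 2, (((m i).valMinAbs : ℤ) : ℝ) ^ 2) ≤ ε ^ 2 then
        ((L : ℂ) ^ 2)⁻¹ • (Matrix.conjTranspose (pairFieldAt dWaveFormFactor L m) *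
          pairFieldAt dWaveFormFactor L m)
      else 0) =
      ∑ x : Fin 2 → ZMod L, (localPair dWaveFormFactor L x)ᴴ * localPair dWaveFormFactor L x :=
  Summit.HubbardSuperconductivity.HubbardSuperconductivity.Theorems.stub_fullWindow L ε hε

/-- **BASE AT THE FULL WINDOW (local form).** `λ⋆ A⋆ L² ≤ minE(H_L + λ⋆ Σ_x P_xᴴP_x | K_L) − minE(H_L | K_L)`
for all large even `L`: an extensive excess of the sector ground energy under a LOCAL translation-
invariant perturbation of the Hubbard torus — by the two-sided sandwich, "a weak local `B₁g`
singlet-bond repulsion leaves local `d`-wave pair density `≥ A⋆` per site in the penalised minimisers".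
[folklore] -/
def BaseGapLocal (U δ lams As : ℝ) : Prop :=
  ∃ L₀ : ℕ, ∀ (L : ℕ) [NeZero L], L₀ ≤ L → Even L →
    lams * As * (L : ℝ) ^ 2 ≤
      (hubbardTorus 2 L 1 U + (lams : ℂ) • localPairRepulsion L).minEnergyOn (holeSector L δ) -
        (hubbardTorus 2 L 1 U).minEnergyOn (holeSector L δ)

/-- The local base is the window base at every full-window radius `ε⋆² ≥ 2π²` (`stub_fullWindow`).
[folklore] -/
theorem baseGap_of_local {U δ εs lams As : ℝ} (hε : 2 * Real.pi ^ 2 ≤ εs ^ 2)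
    (h : BaseGapLocal U δ lams As) : BaseGap U δ εs lams As := by
  obtain ⟨L₀, hL⟩ := h
  refine ⟨L₀, fun L _ hL₀ hE => ?_⟩
  unfold penGap kacWindowOp
  rw [stub_fullWindow L εs hε]
  exact hL L hL₀ hE

/-- **Stub `stub_localCertificate` (THE PHYSICS; HARDEST; open — no supplier in print).** At some
coupling `U > 0` and hole doping `δ ∈ (0, 1/2)` of the pure `t' = 0` Hubbard torus
(`H_L = hubbardTorus 2 L 1 U`, `K_L = szSector N_L 0`, `N_L = 2⌊(1−δ)L²/2⌋`, `P_x = localPair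
dWaveFormFactor L x`, `Δ_d(m) = pairFieldAt dWaveFormFactor L m`, `W_ε = L⁻² Σ_{|q_m| ≤ ε} Δ_d(m)ᴴΔ_d(m)`)
there are a full-window radius `ε⋆ > 0` with `ε⋆² ≥ 2π²`, a base coupling `λ⋆ > 0`, a slope `A⋆`, a
floor `a₀ > 0` and a budget `b : ℕ → ℝ` such that
(i) BASE (local certificate): for all large even `L`,
`λ⋆ A⋆ L² ≤ minE(H_L + λ⋆ Σ_x P_xᴴ P_x | K_L) − minE(H_L | K_L)`;
(ii) GAIN CEILINGS along the parabola `(ε_k, λ_k) = (ε⋆/2^k, λ⋆/4^k)`: for every level `k` some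
`μ_k > 0` such that for all large even `L` the ATTRACTIVE Kac-annulus pair interaction lowers the
level-`(k+1)` penalised sector energy by at most `μ_k b_k L²`:
`minE(X | K_L) − minE(X − μ_k (W_{ε_k} − W_{ε_{k+1}}) | K_L) ≤ μ_k b_k L²`, `X = H_L + λ_{k+1} W_{ε_{k+1}}`;
(iii) BUDGET: `2a₀ ≤ A⋆ − Σ_{k<K} b_k` for every `K`.
(Physically the room in (iii) is the condensate density `m²` minus `O(λ⋆)` drifts — it is `≤ 0` in a
metal, U = 0 Wick calibration of the card — so (i)–(iii) jointly contain `d`-wave pair condensation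
with stiffness at `(U, δ)`: open.) [folklore] -/
theorem stub_localCertificate :
    ∃ U δ εs lams As a₀ : ℝ, ∃ b : ℕ → ℝ, 0 < U ∧ δ ∈ Set.Ioo (0 : ℝ) (1 / 2) ∧ 0 < εs ∧
      2 * Real.pi ^ 2 ≤ εs ^ 2 ∧ 0 < lams ∧ 0 < a₀ ∧
      (∃ L₀ : ℕ, ∀ (L : ℕ) [NeZero L], L₀ ≤ L → Even L →
        lams * As * (L : ℝ) ^ 2 ≤
          (hubbardTorus 2 L 1 U + (lams : ℂ) •
              ∑ x : Fin 2 → ZMod L, (localPair dWaveFormFactor L x)ᴴ * localPair dWaveFormFactor L x).minEnergyOn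
              (szSector (2 * ⌊(1 - δ) * (L : ℝ) ^ 2 / 2⌋₊) 0) -
            (hubbardTorus 2 L 1 U).minEnergyOn (szSector (2 * ⌊(1 - δ) * (L : ℝ) ^ 2 / 2⌋₊) 0)) ∧
      (∀ k : ℕ, ∃ μ : ℝ, 0 < μ ∧ ∃ L₀ : ℕ, ∀ (L : ℕ) [NeZero L], L₀ ≤ L → Even L →
        (hubbardTorus 2 L 1 U + ((lams / 4 ^ (k + 1) : ℝ) : ℂ) •
            ∑ m : Fin 2 → ZMod L,
              if (2 * Real.pi / (L : ℝ)) ^ 2 * (∑ i : Fin 2, (((m i).valMinAbs : ℤ) : ℝ) ^ 2) ≤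
                  (εs / 2 ^ (k + 1)) ^ 2 then
                ((L : ℂ) ^ 2)⁻¹ • (Matrix.conjTranspose (pairFieldAt dWaveFormFactor L m) *
                  pairFieldAt dWaveFormFactor L m)
              else 0).minEnergyOn (szSector (2 * ⌊(1 - δ) * (L : ℝ) ^ 2 / 2⌋₊) 0) -
          (hubbardTorus 2 L 1 U + ((lams / 4 ^ (k + 1) : ℝ) : ℂ) •
              (∑ m : Fin 2 → ZMod L,
                if (2 * Real.pi / (L : ℝ)) ^ 2 * (∑ i : Fin 2, (((m i).valMinAbs : ℤ) : ℝ) ^ 2) ≤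
                    (εs / 2 ^ (k + 1)) ^ 2 then
                  ((L : ℂ) ^ 2)⁻¹ • (Matrix.conjTranspose (pairFieldAt dWaveFormFactor L m) *
                    pairFieldAt dWaveFormFactor L m)
                else 0) -
            (μ : ℂ) • ((∑ m : Fin 2 → ZMod L,
                if (2 * Real.pi / (L : ℝ)) ^ 2 * (∑ i : Fin 2, (((m i).valMinAbs : ℤ) : ℝ) ^ 2) ≤
                    (εs / 2 ^ k) ^ 2 then
                  ((L : ℂ) ^ 2)⁻¹ • (Matrix.conjTranspose (pairFieldAt dWaveFormFactor L m) *
                    pairFieldAt dWaveFormFactor L m)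
                else 0) -
              (∑ m : Fin 2 → ZMod L,
                if (2 * Real.pi / (L : ℝ)) ^ 2 * (∑ i : Fin 2, (((m i).valMinAbs : ℤ) : ℝ) ^ 2) ≤
                    (εs / 2 ^ (k + 1)) ^ 2 then
                  ((L : ℂ) ^ 2)⁻¹ • (Matrix.conjTranspose (pairFieldAt dWaveFormFactor L m) *
                    pairFieldAt dWaveFormFactor L m)
                else 0))).minEnergyOn (szSector (2 * ⌊(1 - δ) * (L : ℝ) ^ 2 / 2⌋₊) 0) ≤
          μ * b k * (L : ℝ) ^ 2) ∧
      ∀ K : ℕ, 2 * a₀ ≤ As - ∑ k ∈ Finset.range K, b k := by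
  sorry

/-- **`WindowGap_of` — the line's composition.** The local base transported to the full window
(`baseGap_of_local`, via `stub_fullWindow`), then the parabolic descent with gain ceilings
(`windowGapAt_of_base_gain`). The stub's inline clauses (i)/(ii) are `BaseGapLocal`/`GainLaw` by
`Iff.rfl`. Sorry-free outside the two stubs. [folklore] -/
theorem WindowGap_of : WindowGap := by
  obtain ⟨U, δ, εs, lams, As, a₀, b, hU, hδ, hεpos, hε, hlam, ha₀, hbase, hgain, hbudget⟩ :=
    stub_localCertificate
  have hbase' : BaseGapLocal U δ lams As := hbase
  have hgain' : GainLaw U δ εs lams b := hgain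
  exact ⟨U, hU, δ, hδ,
    windowGapAt_of_base_gain hδ hεpos hlam ha₀ (baseGap_of_local hε hbase') hgain' hbudget⟩

end Summit.HubbardSuperconductivity.HubbardSuperconductivity.Cruxes.WindowGap.ParabolicDescent
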